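import Summits.BirchSwinnertonDyer.BirchSwinnertonDyer.Theses.DerivedKatoValuationDoor
import Summits.BirchSwinnertonDyer.Rank1Residual.Additive.KatoDescentLocPKummerLogOfClass
import Literature.NumberTheory.EllipticCurves.IntegralH1LocalisationRankDictionary
import Mathlib.LinearAlgebra.Dimension.Finite
import HarnessLib

set_option linter.dupNamespace false
set_option autoImplicit false

/-!
# Stub S2 `stub_integralH1RankLeTwoOfAnalyticRankTwo` of line `descent` (crux stmt-BirchSwinnertonDyer-23259
# `FineLengthLeOneOfAnalyticRankTwo`, route `DerivedKatoValuationDoor`) REDUCED BY NAME to the printed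
# Poitou–Tate rank dictionary: S2 ⟸ `PerrinRiou1993.lemme239_rank_integralH1_eq_selmerCorank` ∧ `SelCapTwoAt` ∧
# `CrisAtDoorPrimes`; and the (β)-glue S2 → `hstr` ⟸ `KuriharaPollack2007.lemma14_locP_image_rankOne`
# (INPUTS desk row τ7 = G101; seat `bsd-inputs-honda-p1` g14; helper `--supports 23259`, closes nothing)

Stub S2 (OPEN, registered on stmt-BirchSwinnertonDyer-23259, skeleton `Lines/descent.lean` r5) reads: at a door
prime `p` (`5 ≤ p`, good ordinary, `ρ̄` onto) of a globally minimal `W/ℚ` with analytic rank `2`,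
`Module.rank ℤ_[p] ↥(integralH1 (tateRep W p) p ⊤) ≤ 2`.  Its docstring prints the dictionary «`rank = 1 + s`,
`s = s_p − ε_p` (Poitou–Tate; the image of `loc_p` is one line), so S2 ⟺ (at `a = 2`) `s_p = 2 ∧ ε_p = 1`».
The INPUTS desk (row τ7, director-bsd 2026-08-28) typed the two print inputs as named facts on the tree's pinned
objects (`Literature/NumberTheory/EllipticCurves/IntegralH1LocalisationRankDictionary.lean`):

* `PerrinRiou1993.lemme239_rank_integralH1_eq_selmerCorank` — [PR93, Lemme 2.3.9] with the Kato §14.1 /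
  Bloch–Kato Ex. 3.11 dictionary: ONE integral class with a Kummer localisation of non-zero logarithm
  (`ε_p = 1`) ⟹ `rank_{ℤ_p} H¹(ℤ[1/p], T_pW) = corank_{ℤ_p} Sel_{p^∞}(W/ℚ)` (`W.selmerCorank p`);
* `KuriharaPollack2007.lemma14_locP_image_rankOne` — [KP07, Lemma 1.4]: the image of `loc_p` on
  `H¹(ℤ[1/p], T_pW)` has `ℤ_p`-rank EXACTLY one (pair dependence modulo the strict part + one class with
  non-torsion localisation).

This file proves, as kernel theorems (no `sorry`, standard axioms):

* §1 `locModPk_smul_eq_zero` — the strict part is `ℤ_p`-stable (`loc_p mod p^k` is `ℤ_p`-semilinear).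
* §2 **`rank_integralH1_le_two_of_lemme239`** (per `(W, p)`) and
  **`integralH1RankLeTwo_of_lemme239_of_selCap_of_crisAt`**: the registered signature of S2 VERBATIM from
  {`lemme239_rank_integralH1_eq_selmerCorank`} ∪ {`SelCapTwoAt` at door primes, spelled
  `W.analyticRank = 2 → door → W.selmerCorank p ≤ 2`} ∪ {the route's rider `CrisAtDoorPrimes`
  (stmt-BirchSwinnertonDyer-23148) BY NAME} — G101 of the desk: linear arithmetic by name.
* §3 **`strictPairDependent_of_rank_le_two_of_lemma14`** (per `(W, p)`) and
  **`strictRankLeOne_of_integralH1RankLeTwo_of_lemma14`**: the glue «S2 → `hstr`» of the tenure's (β)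
  re-split — `rank ≤ 2` together with [KP07, Lemma 1.4] (one class of non-torsion localisation) forces any two
  STRICT integral classes (`∀ k, locModPk W p k x = 0`) to be `ℤ_p`-dependent, i.e. the conclusion shape of
  the route's support `StrictRankLeDerivedOrder` / the hypothesis of `StrictCapGivesSelmerCap` — elementary
  linear algebra over the domain `ℤ_p` (`LinearIndependent.cardinal_le_rank` on the triple).
* §4 **`forall_hasLocPKummerLog_of_crisAt`**: at a door prime of an analytic-rank-two curve, `CrisAtDoorPrimes`
  makes EVERY integral class Kummer at `p` — the first assertion of [PR93, Lemme 2.3.9] at door primes,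
  UNCONDITIONALLY, by the tree theorem `LocPKummer.hasLocPKummerLog_of_exists_log_ne_zero_of_mem_integralH1`
  (so the residual of the Perrin-Riou fact at door primes is exactly the compact-vs-discrete Selmer rank
  dictionary).

HONEST FRAMING.  §2 and §3 are CONDITIONAL reductions on named facts (D-0014; the gate records
`conditional-result`); §1, §4 are unconditional; no stub is proved as registered, no item is closed; the open
content of S2 after this file is displayed as {PR93 2.3.9-dictionary (print), `s_p ≤ 2` at `a = 2`
(`SelCapTwoAt`, BSD-strength), `ε_p = 1` (`CrisAtDoorPrimes`, open without a rational point)}.  Nothing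
about BSD is proved by any of this.

References: [PR93] = [cite: PerrinRiou1993AIF, Lemme 2.3.9 (p. 967)]; [KP07] = [cite: KuriharaPollack2007, §1.4 Lemma 1.4];
[Kato04] = [cite: Kato2004Asterisque, §8.2, §14.1 (pp. 234–235)]; [BKS19] = [cite: BurnsKuriharaSano2019, Prop. 4.5].
-/

noncomputable section

open scoped Classical

namespace Summit.BirchSwinnertonDyer.BirchSwinnertonDyer.Theorems.DerivedKatoValuationDoor

open Field
open Literature Literature.NumberTheory.GaloisRepresentations
open Literature.NumberTheory.EllipticCurves Literature.NumberTheory.EllipticCurves.Kato2004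
open Literature.NumberTheory.EllipticCurves.Kato2004.EulerSystemValues
open Summit.BirchSwinnertonDyer.BirchSwinnertonDyer.Theses.DerivedKatoValuationDoor (CrisAtDoorPrimes)

/-! ## §1 The strict part is `ℤ_p`-stable -/

section Strict

variable (W : WeierstrassCurve ℚ) [W.IsElliptic] (p : ℕ) [Fact p.Prime] [ContinuousSMul ℤ_[p] (W.tateModule p)]

/-- `loc_p mod p^k` only sees a `p`-adic scalar `c` through its digit approximation `c mod p^k`
(`ContraCount.locModPk_smul_eq_locModPk_appr_smul`), so it kills `c • z` as soon as it kills `z`: the strict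
part «`∀ k, locModPk W p k z = 0`» of `H¹(Γ_ℚ, T_pW)` is a `ℤ_p`-submodule. [cite: Kato2004Asterisque, §13.8 (p. 228)] -/
theorem locModPk_smul_eq_zero (k : ℕ) (c : ℤ_[p]) (z : H1 (tateRep W p) ⊤)
    (hz : locModPk W p k z = 0) : locModPk W p k (c • z) = 0 := by
  rw [Summit.BirchSwinnertonDyer.Rank1Residual.Additive.ContraCount.locModPk_smul_eq_locModPk_appr_smul,
    map_nsmul, hz, smul_zero]

/-- The strict part is closed under `ℤ_p`-linear combinations: if `loc_p x ≡ 0` and `loc_p y ≡ 0` at level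
`p^k`, then so does `a • x + b • y`. [cite: Kato2004Asterisque, §13.8 (p. 228)] -/
theorem locModPk_smul_add_smul_eq_zero (k : ℕ) (a b : ℤ_[p]) (x y : H1 (tateRep W p) ⊤)
    (hx : locModPk W p k x = 0) (hy : locModPk W p k y = 0) :
    locModPk W p k (a • x + b • y) = 0 := by
  rw [map_add, locModPk_smul_eq_zero W p k a x hx, locModPk_smul_eq_zero W p k b y hy, add_zero]

end Strict

/-! ## §2 S2 from Perrin-Riou's Lemme 2.3.9 (rank dictionary), `s_p ≤ 2` and `ε_p = 1` -/

section RankLeTwo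

variable (W : WeierstrassCurve ℚ) [W.IsElliptic] [W.IsGloballyMinimal] (p : ℕ) [Fact p.Prime]
  [ContinuousSMul ℤ_[p] (W.tateModule p)]

/-- **S2 at `(W, p)` from the dictionary (G101, per curve and prime).**  If `rank_{ℤ_p} H¹(ℤ[1/p], T_pW) =
corank Sel_{p^∞}(W/ℚ)` whenever some integral class has a Kummer localisation of non-zero logarithm (the named
fact `PerrinRiou1993.lemme239_rank_integralH1_eq_selmerCorank`, [PR93, Lemme 2.3.9] + Kato §14.1), then at an odd
good prime `p` with `corank Sel_{p^∞}(W/ℚ) ≤ 2` (`s_p ≤ 2`) and such a class (`ε_p = 1`) one has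
`rank_{ℤ_p} H¹(ℤ[1/p], T_pW) ≤ 2`.  CONDITIONAL on the named fact.
[cite: PerrinRiou1993AIF, Lemme 2.3.9 (p. 967)] [cite: Kato2004Asterisque, §14.1 (pp. 234–235)] -/
theorem rank_integralH1_le_two_of_lemme239
    (hPR : PerrinRiou1993.lemme239_rank_integralH1_eq_selmerCorank)
    (hp2 : p ≠ 2) (hgood : W.HasGoodReductionAtPrime p) (hsel : W.selmerCorank p ≤ 2)
    (hx : ∃ (x : H1 (tateRep W p) ⊤) (t : ℚ_[p]),
      x ∈ integralH1 (tateRep W p) p ⊤ ∧ t ≠ 0 ∧ HasLocPKummerLog W p x t) :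
    Module.rank ℤ_[p] ↥(integralH1 (tateRep W p) p ⊤) ≤ 2 := by
  rw [hPR W p hp2 hgood hx]
  exact_mod_cast hsel

/-- **S2 at `(W, p)`, equality form**: under the same named fact, at an odd good prime with a Kummer witness of
non-zero logarithm, `rank_{ℤ_p} H¹(ℤ[1/p], T_pW) ≤ n ↔ corank Sel_{p^∞}(W/ℚ) ≤ n` for every `n` — S2 IS
`s_p ≤ 2` on the `ε_p = 1` locus.  CONDITIONAL on the named fact.
[cite: PerrinRiou1993AIF, Lemme 2.3.9 (p. 967)] [cite: Kato2004Asterisque, §14.1 (pp. 234–235)] -/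
theorem rank_integralH1_le_iff_selmerCorank_le_of_lemme239
    (hPR : PerrinRiou1993.lemme239_rank_integralH1_eq_selmerCorank)
    (hp2 : p ≠ 2) (hgood : W.HasGoodReductionAtPrime p)
    (hx : ∃ (x : H1 (tateRep W p) ⊤) (t : ℚ_[p]),
      x ∈ integralH1 (tateRep W p) p ⊤ ∧ t ≠ 0 ∧ HasLocPKummerLog W p x t) (n : ℕ) :
    Module.rank ℤ_[p] ↥(integralH1 (tateRep W p) p ⊤) ≤ n ↔ W.selmerCorank p ≤ n := by
  rw [hPR W p hp2 hgood hx]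
  exact_mod_cast Iff.rfl

end RankLeTwo

/-- **G101 — the registered signature of stub S2 `stub_integralH1RankLeTwoOfAnalyticRankTwo` VERBATIM, from
{`PerrinRiou1993.lemme239_rank_integralH1_eq_selmerCorank`} ∪ {`SelCapTwoAt` at door primes} ∪ {`CrisAtDoorPrimes`}
BY NAME.**  At a door prime `p` (`5 ≤ p`, good ordinary, `ρ̄` onto) of a globally minimal `W/ℚ` of analytic rank
`2`: `CrisAtDoorPrimes` (rider stmt-BirchSwinnertonDyer-23148) supplies an integral class of non-zero Kummer
logarithm (`ε_p = 1`), the Perrin-Riou dictionary turns `rank_{ℤ_p} H¹(ℤ[1/p], T_pW)` into `corank Sel_{p^∞}(W/ℚ)`,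
and `SelCapTwoAt` (`a = 2 ⇒ s_p ≤ 2`, spelled at door primes; card vocabulary `S0Doors.SelCapTwoAt`) bounds it by
`2`; `p ≠ 2` from `5 ≤ p` and good reduction from `IsOrdinaryAt` (`isOrdinaryAt_iff`).  CONDITIONAL reduction
(helper; the stub is NOT proved as registered).  [cite: PerrinRiou1993AIF, Lemme 2.3.9 (p. 967)]
[cite: KuriharaPollack2007, §1.4 Lemma 1.4] [cite: BurnsKuriharaSano2019, Prop. 4.5 (proof)] -/
theorem integralH1RankLeTwo_of_lemme239_of_selCap_of_crisAt
    (hPR : PerrinRiou1993.lemme239_rank_integralH1_eq_selmerCorank)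
    (hSel : ∀ (W : WeierstrassCurve ℚ) [W.IsElliptic] [W.IsGloballyMinimal] (p : ℕ) [Fact p.Prime],
      W.analyticRank = 2 →
        (5 ≤ p ∧ Literature.NumberTheory.EllipticCurves.IsOrdinaryAt W p ∧ W.HasSurjectiveModNGaloisRep p) →
          W.selmerCorank p ≤ 2)
    (hCris : CrisAtDoorPrimes) :
    ∀ (W : WeierstrassCurve ℚ) [W.IsElliptic] [W.IsGloballyMinimal] (p : ℕ) [Fact p.Prime]
      [ContinuousSMul ℤ_[p] (W.tateModule p)], W.analyticRank = 2 →
      (5 ≤ p ∧ Literature.NumberTheory.EllipticCurves.IsOrdinaryAt W p ∧ W.HasSurjectiveModNGaloisRep p) →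
      Module.rank ℤ_[p]
          ↥(Literature.NumberTheory.EllipticCurves.Kato2004.integralH1
            (Literature.NumberTheory.EllipticCurves.Kato2004.EulerSystemValues.tateRep W p) p ⊤) ≤ 2 := by
  intro W _ _ p _ _ ha hdoor
  obtain ⟨x, t, hx, ht, hlog⟩ := hCris W p ha hdoor
  have hp2 : p ≠ 2 := by
    have h5 := hdoor.1
    omega
  have hgood : W.HasGoodReductionAtPrime p := ((isOrdinaryAt_iff W p).1 hdoor.2.1).1
  exact rank_integralH1_le_two_of_lemme239 W p hPR hp2 hgood (hSel W p ha hdoor) ⟨x, t, hx, ht, hlog⟩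

/-! ## §3 The (β)-glue S2 → `hstr` from Kurihara–Pollack's Lemma 1.4 -/

section StrictRank

variable (W : WeierstrassCurve ℚ) [W.IsElliptic] (p : ℕ) [Fact p.Prime] [ContinuousSMul ℤ_[p] (W.tateModule p)]

/-- **`rank ≤ 2` + one class of non-torsion localisation ⟹ any two STRICT integral classes are
`ℤ_p`-dependent** (per `(W, p)`; the mechanism of the glue «S2 → `hstr`»).  If `x₀ ∈ H¹(ℤ[1/p], T_pW)` has
`loc_p (a • x₀) ≢ 0` for every `a ≠ 0` (the `≥ 1` half of [KP07, Lemma 1.4]) and `rank_{ℤ_p} H¹(ℤ[1/p], T_pW) ≤ 2`,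
then for strict integral `x, y` (`loc_p ≡ 0` at every level) the triple `(x₀, x, y)` is dependent
(`LinearIndependent.cardinal_le_rank`), and the coefficient of `x₀` must vanish because the strict part is a
submodule (§1) missing `a • x₀`; what remains is a non-trivial relation between `x` and `y`.  Unconditional
linear algebra over the domain `ℤ_p`. [cite: KuriharaPollack2007, §1.4 Lemma 1.4] [cite: BurnsKuriharaSano2019, Prop. 4.5 (proof)] -/
theorem strictPairDependent_of_rank_le_two_of_nonTorsionLoc
    (hrank : Module.rank ℤ_[p] ↥(integralH1 (tateRep W p) p ⊤) ≤ 2)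
    {x₀ : H1 (tateRep W p) ⊤} (hx₀ : x₀ ∈ integralH1 (tateRep W p) p ⊤)
    (hx₀loc : ∀ a : ℤ_[p], a ≠ 0 → ∃ k : ℕ, locModPk W p k (a • x₀) ≠ 0)
    (x y : H1 (tateRep W p) ⊤) (hx : x ∈ integralH1 (tateRep W p) p ⊤)
    (hy : y ∈ integralH1 (tateRep W p) p ⊤) (hxs : ∀ k : ℕ, locModPk W p k x = 0)
    (hys : ∀ k : ℕ, locModPk W p k y = 0) :
    ∃ a b : ℤ_[p], (a ≠ 0 ∨ b ≠ 0) ∧ a • x + b • y = 0 := by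
  set A := integralH1 (tateRep W p) p ⊤ with hA
  -- the triple `(x₀, x, y)` in `A` is linearly dependent since `rank A ≤ 2 < 3`
  let v : Fin 3 → ↥A := ![⟨x₀, hx₀⟩, ⟨x, hx⟩, ⟨y, hy⟩]
  have hdep : ¬ LinearIndependent ℤ_[p] v := by
    intro hli
    have h3 : (3 : Cardinal) ≤ Module.rank ℤ_[p] ↥A := by
      simpa using hli.cardinal_le_rank
    have : (3 : Cardinal) ≤ 2 := h3.trans hrank
    norm_num at this
  obtain ⟨g, hg, i, hi⟩ := Fintype.not_linearIndependent_iff.mp hdep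
  -- the relation, read in `H¹(Γ_ℚ, T_pW)`
  have hrel : g 0 • x₀ + g 1 • x + g 2 • y = 0 := by
    have h := congrArg (fun z : ↥A => (z : H1 (tateRep W p) ⊤)) hg
    simpa [v, Fin.sum_univ_three, add_assoc] using h
  -- the coefficient of `x₀` vanishes: otherwise `g 0 • x₀ = -(g 1 • x + g 2 • y)` would be strict
  have hg0 : g 0 = 0 := by
    by_contra hne
    obtain ⟨k, hk⟩ := hx₀loc (g 0) hne
    apply hk
    have hstrict : locModPk W p k (g 1 • x + g 2 • y) = 0 :=
      locModPk_smul_add_smul_eq_zero W p k (g 1) (g 2) x y (hxs k) (hys k)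
    have heq : g 0 • x₀ = -(g 1 • x + g 2 • y) := by
      rw [eq_neg_iff_add_eq_zero, ← add_assoc]
      exact hrel
    rw [heq, map_neg, hstrict, neg_zero]
  refine ⟨g 1, g 2, ?_, ?_⟩
  · -- some coefficient is non-zero, and it is not `g 0`
    by_contra hboth
    push Not at hboth
    apply hi
    fin_cases i
    · exact hg0
    · exact hboth.1
    · exact hboth.2
  · have := hrel
    rw [hg0, zero_smul, zero_add] at this
    exact this

/-- **The glue «S2 → `hstr`» at `(W, p)` from [KP07, Lemma 1.4] BY NAME**: at an odd good prime, if the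
localisation image has `ℤ_p`-rank exactly one (named fact `KuriharaPollack2007.lemma14_locP_image_rankOne`; only
its `≥ 1` half is used) and `rank_{ℤ_p} H¹(ℤ[1/p], T_pW) ≤ 2`, then any two strict integral classes are
`ℤ_p`-dependent («strict rank `≤ 1`», the conclusion shape of the route's support `StrictRankLeDerivedOrder` and
the hypothesis of `StrictCapGivesSelmerCap`).  CONDITIONAL on the named fact.
[cite: KuriharaPollack2007, §1.4 Lemma 1.4] [cite: BurnsKuriharaSano2019, Prop. 4.5 (proof)] -/
theorem strictPairDependent_of_rank_le_two_of_lemma14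
    (hKP : KuriharaPollack2007.lemma14_locP_image_rankOne)
    (hp2 : p ≠ 2) (hgood : W.HasGoodReductionAtPrime p)
    (hrank : Module.rank ℤ_[p] ↥(integralH1 (tateRep W p) p ⊤) ≤ 2)
    (x y : H1 (tateRep W p) ⊤) (hx : x ∈ integralH1 (tateRep W p) p ⊤)
    (hy : y ∈ integralH1 (tateRep W p) p ⊤) (hxs : ∀ k : ℕ, locModPk W p k x = 0)
    (hys : ∀ k : ℕ, locModPk W p k y = 0) :
    ∃ a b : ℤ_[p], (a ≠ 0 ∨ b ≠ 0) ∧ a • x + b • y = 0 := by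
  obtain ⟨x₀, hx₀, hx₀loc⟩ := (hKP W p hp2 hgood).2
  exact strictPairDependent_of_rank_le_two_of_nonTorsionLoc W p hrank hx₀ hx₀loc x y hx hy hxs hys

end StrictRank

/-- **The glue «S2 → `hstr`» at door primes, route shape**: from [KP07, Lemma 1.4] BY NAME and the registered
signature of stub S2 (`rank_{ℤ_p} H¹(ℤ[1/p], T_pW) ≤ 2` at door primes of analytic-rank-two globally minimal
curves) follows «strict rank `≤ 1`» at those primes in the pair-dependence currency of
`StrictRankLeDerivedOrder` / `StrictCapGivesSelmerCap` (so `closes` can be fed from S2: `hstr := this W p ha hdoor`,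
then `StrictCapGivesSelmerCap`, then Kummer).  CONDITIONAL on the named fact; the tenure's (β) re-split
(S2 summit-bearing) is kernel-checkable modulo [KP07, Lemma 1.4] with this lemma.
[cite: KuriharaPollack2007, §1.4 Lemma 1.4] [cite: BurnsKuriharaSano2019, Prop. 4.5 (proof)] -/
theorem strictRankLeOne_of_integralH1RankLeTwo_of_lemma14
    (hKP : KuriharaPollack2007.lemma14_locP_image_rankOne)
    (hS2 : ∀ (W : WeierstrassCurve ℚ) [W.IsElliptic] [W.IsGloballyMinimal] (p : ℕ) [Fact p.Prime]
      [ContinuousSMul ℤ_[p] (W.tateModule p)], W.analyticRank = 2 →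
      (5 ≤ p ∧ Literature.NumberTheory.EllipticCurves.IsOrdinaryAt W p ∧ W.HasSurjectiveModNGaloisRep p) →
      Module.rank ℤ_[p]
          ↥(Literature.NumberTheory.EllipticCurves.Kato2004.integralH1
            (Literature.NumberTheory.EllipticCurves.Kato2004.EulerSystemValues.tateRep W p) p ⊤) ≤ 2) :
    ∀ (W : WeierstrassCurve ℚ) [W.IsElliptic] [W.IsGloballyMinimal] (p : ℕ) [Fact p.Prime]
      [ContinuousSMul ℤ_[p] (W.tateModule p)], W.analyticRank = 2 →
      (5 ≤ p ∧ Literature.NumberTheory.EllipticCurves.IsOrdinaryAt W p ∧ W.HasSurjectiveModNGaloisRep p) →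
      ∀ x y : H1 (tateRep W p) ⊤,
        x ∈ integralH1 (tateRep W p) p ⊤ → y ∈ integralH1 (tateRep W p) p ⊤ →
        (∀ k : ℕ, locModPk W p k x = 0) → (∀ k : ℕ, locModPk W p k y = 0) →
          ∃ a b : ℤ_[p], (a ≠ 0 ∨ b ≠ 0) ∧ a • x + b • y = 0 := by
  intro W _ _ p _ _ ha hdoor x y hx hy hxs hys
  have hp2 : p ≠ 2 := by
    have h5 := hdoor.1
    omega
  have hgood : W.HasGoodReductionAtPrime p := ((isOrdinaryAt_iff W p).1 hdoor.2.1).1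
  exact strictPairDependent_of_rank_le_two_of_lemma14 W p hKP hp2 hgood (hS2 W p ha hdoor) x y hx hy hxs hys

/-! ## §4 At a door prime, `CrisAtDoorPrimes` makes every integral class Kummer at `p` (unconditional) -/

/-- **Perrin-Riou's Lemme 2.3.9, first assertion, at door primes — UNCONDITIONALLY from the rider
`CrisAtDoorPrimes`**: at a door prime of a globally minimal analytic-rank-two `W/ℚ`, if some integral class has
a Kummer localisation of non-zero logarithm (the rider stmt-BirchSwinnertonDyer-23148), then EVERY class of
`H¹(ℤ[1/p], T_pW)` localises at `p` to a Kummer class (`HasLocPKummerLog W p y t'` for some `t'`): the tree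
theorem `LocPKummer.hasLocPKummerLog_of_exists_log_ne_zero_of_mem_integralH1` (the Kurihara–Pollack line for
integral classes, from the tree's Poitou–Tate engine).  Hence at door primes the residual of the named fact
`PerrinRiou1993.lemme239_rank_integralH1_eq_selmerCorank` is ONLY the compact-versus-discrete Selmer rank
dictionary «`rank_{ℤ_p}` (integral Kummer classes) `= corank Sel_{p^∞}`».  Unconditional given the rider.
[cite: PerrinRiou1993AIF, Lemme 2.3.9 (p. 967)] [cite: KuriharaPollack2007, §1.4 Lemma 1.4] -/
theorem forall_hasLocPKummerLog_of_crisAt (hCris : CrisAtDoorPrimes)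
    (W : WeierstrassCurve ℚ) [W.IsElliptic] [W.IsGloballyMinimal] (p : ℕ) [Fact p.Prime]
    [ContinuousSMul ℤ_[p] (W.tateModule p)] (ha : W.analyticRank = 2)
    (hdoor : 5 ≤ p ∧ Literature.NumberTheory.EllipticCurves.IsOrdinaryAt W p ∧ W.HasSurjectiveModNGaloisRep p)
    {y : H1 (tateRep W p) ⊤} (hy : y ∈ integralH1 (tateRep W p) p ⊤) :
    ∃ t' : ℚ_[p], HasLocPKummerLog W p y t' := by
  obtain ⟨x, t, hx, ht, hlog⟩ := hCris W p ha hdoor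
  exact Summit.BirchSwinnertonDyer.Rank1Residual.Additive.LocPKummer.hasLocPKummerLog_of_exists_log_ne_zero_of_mem_integralH1
    W p ⟨x, t, hx, ht, hlog⟩ hy

/-! ## §5 The `≥ 1` half of [KP07, Lemma 1.4] and the glue S2 → `hstr` from the RIDER alone (no named fact)

Appended (same seat, same session): a Kummer localisation of NON-ZERO logarithm is never `ℤ_p`-torsion modulo
`p^k` at all levels — so the rider `CrisAtDoorPrimes` already supplies, at door primes, the class with non-torsion
localisation that §3 took from `KuriharaPollack2007.lemma14_locP_image_rankOne`; hence the (β)-glue S2 → `hstr`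
holds modulo the rider ONLY (unconditional linear algebra + the tree's uniqueness of the Kummer logarithm,
`ContraCount.hasLocPKummerLog_smul_eq`, Bloch–Kato Ex. 3.11 in finite-level currency). -/

section NonTorsion

variable (W : WeierstrassCurve ℚ) [W.IsElliptic] [W.IsGloballyMinimal] (p : ℕ) [Fact p.Prime]
  [ContinuousSMul ℤ_[p] (W.tateModule p)]

/-- A class whose localisation at `p` vanishes at every level has Kummer logarithm `0` (witness `(1, 0)`:
`loc_p(1 • z) ≡ 0 = κ_k(0)` and `log_ω(0) = 0`). [cite: BlochKato1990, Def. 3.10 and Ex. 3.11] -/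
theorem hasLocPKummerLog_zero_of_forall_locModPk_eq_zero (z : H1 (tateRep W p) ⊤)
    (hz : ∀ k : ℕ, locModPk W p k z = 0) : HasLocPKummerLog W p z 0 := by
  refine ⟨1, 0, one_ne_zero, fun k ↦ ?_, ?_⟩
  · rw [one_smul, hz k, map_zero, map_zero]
  · rw [mul_zero,
      Summit.BirchSwinnertonDyer.BirchSwinnertonDyer.Theorems.CongruentShaFreeCutKatoKummerLogTorsion.padicLogLocal_eq_padicLog,
      map_zero]

/-- **A Kummer localisation of non-zero logarithm is not torsion**: if `HasLocPKummerLog W p x t` with `t ≠ 0`,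
then for every `a ≠ 0` in `ℤ_p` some level sees `loc_p (a • x) ≢ 0 (mod p^k)`.  Otherwise `a • x` would have
Kummer logarithm `0` (previous lemma) while homogeneity/uniqueness of the logarithm
(`ContraCount.hasLocPKummerLog_smul_eq` with `a • x = 1 • (a • x)`) gives it logarithm `a · t ≠ 0`.  This is the
`≥ 1` half of [KP07, Lemma 1.4] («the image of `loc_p` is a line», so non-zero) at any `(W, p)` carrying such a
class — in particular at door primes under the rider `CrisAtDoorPrimes`.  Unconditional.
[cite: KuriharaPollack2007, §1.4 Lemma 1.4] [cite: BlochKato1990, Def. 3.10 and Ex. 3.11] -/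
theorem nonTorsionLoc_of_hasLocPKummerLog_ne_zero {x : H1 (tateRep W p) ⊤} {t : ℚ_[p]}
    (hx : HasLocPKummerLog W p x t) (ht : t ≠ 0) :
    ∀ a : ℤ_[p], a ≠ 0 → ∃ k : ℕ, locModPk W p k (a • x) ≠ 0 := by
  intro a ha
  by_contra hall
  push Not at hall
  have h0 : HasLocPKummerLog W p (a • x) 0 :=
    hasLocPKummerLog_zero_of_forall_locModPk_eq_zero W p (a • x) hall
  have h := Summit.BirchSwinnertonDyer.Rank1Residual.Additive.ContraCount.hasLocPKummerLog_smul_eq W p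
    (c₁ := a) (c₂ := 1) (x := x) (y := a • x) (by rw [one_smul]) hx h0
  rw [mul_zero, mul_eq_zero] at h
  rcases h with h | h
  · exact (PadicInt.coe_ne_zero.mpr ha) h
  · exact ht h

/-- **The `≥ 1` half of [KP07, Lemma 1.4] at door primes, from the rider alone**: under `CrisAtDoorPrimes`, at a
door prime of a globally minimal analytic-rank-two `W/ℚ` there is an integral class `x ∈ H¹(ℤ[1/p], T_pW)` with
`loc_p (a • x) ≢ 0` for every `a ≠ 0` — the second conjunct of `KuriharaPollack2007.lemma14_locP_image_rankOne`
at those `(W, p)`, UNCONDITIONALLY given the rider. [cite: KuriharaPollack2007, §1.4 Lemma 1.4] -/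
theorem exists_nonTorsionLoc_of_crisAt (hCris : CrisAtDoorPrimes)
    (W : WeierstrassCurve ℚ) [W.IsElliptic] [W.IsGloballyMinimal] (p : ℕ) [Fact p.Prime]
    [ContinuousSMul ℤ_[p] (W.tateModule p)] (ha : W.analyticRank = 2)
    (hdoor : 5 ≤ p ∧ Literature.NumberTheory.EllipticCurves.IsOrdinaryAt W p ∧ W.HasSurjectiveModNGaloisRep p) :
    ∃ x : H1 (tateRep W p) ⊤, x ∈ integralH1 (tateRep W p) p ⊤ ∧
      ∀ a : ℤ_[p], a ≠ 0 → ∃ k : ℕ, locModPk W p k (a • x) ≠ 0 := by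
  obtain ⟨x, t, hx, ht, hlog⟩ := hCris W p ha hdoor
  exact ⟨x, hx, nonTorsionLoc_of_hasLocPKummerLog_ne_zero W p hlog ht⟩

/-- **Strict pair dependence at `(W, p)` from `rank ≤ 2` and ONE Kummer class of non-zero logarithm** (no named
fact): combine `nonTorsionLoc_of_hasLocPKummerLog_ne_zero` with the linear algebra of
`strictPairDependent_of_rank_le_two_of_nonTorsionLoc`. [cite: KuriharaPollack2007, §1.4 Lemma 1.4]
[cite: BurnsKuriharaSano2019, Prop. 4.5 (proof)] -/
theorem strictPairDependent_of_rank_le_two_of_hasLocPKummerLog_ne_zero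
    (hrank : Module.rank ℤ_[p] ↥(integralH1 (tateRep W p) p ⊤) ≤ 2)
    {x₀ : H1 (tateRep W p) ⊤} {t : ℚ_[p]} (hx₀ : x₀ ∈ integralH1 (tateRep W p) p ⊤)
    (hx₀log : HasLocPKummerLog W p x₀ t) (ht : t ≠ 0)
    (x y : H1 (tateRep W p) ⊤) (hx : x ∈ integralH1 (tateRep W p) p ⊤)
    (hy : y ∈ integralH1 (tateRep W p) p ⊤) (hxs : ∀ k : ℕ, locModPk W p k x = 0)
    (hys : ∀ k : ℕ, locModPk W p k y = 0) :
    ∃ a b : ℤ_[p], (a ≠ 0 ∨ b ≠ 0) ∧ a • x + b • y = 0 :=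
  strictPairDependent_of_rank_le_two_of_nonTorsionLoc W p hrank hx₀
    (nonTorsionLoc_of_hasLocPKummerLog_ne_zero W p hx₀log ht) x y hx hy hxs hys

end NonTorsion

/-- **The glue «S2 → `hstr`» at door primes from the RIDER `CrisAtDoorPrimes` ALONE (no named fact)**: the
registered signature of stub S2 together with `CrisAtDoorPrimes` (stmt-BirchSwinnertonDyer-23148) yields strict pair
dependence at door primes of analytic-rank-two globally minimal curves — the conclusion shape of
`StrictRankLeDerivedOrder` / the hypothesis of `StrictCapGivesSelmerCap`.  Twin of
`strictRankLeOne_of_integralH1RankLeTwo_of_lemma14` with the print fact replaced by the rider; unconditional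
given the two hypotheses.  BSD is not proved by any of this.
[cite: KuriharaPollack2007, §1.4 Lemma 1.4] [cite: BurnsKuriharaSano2019, Prop. 4.5 (proof)] -/
theorem strictRankLeOne_of_integralH1RankLeTwo_of_crisAt (hCris : CrisAtDoorPrimes)
    (hS2 : ∀ (W : WeierstrassCurve ℚ) [W.IsElliptic] [W.IsGloballyMinimal] (p : ℕ) [Fact p.Prime]
      [ContinuousSMul ℤ_[p] (W.tateModule p)], W.analyticRank = 2 →
      (5 ≤ p ∧ Literature.NumberTheory.EllipticCurves.IsOrdinaryAt W p ∧ W.HasSurjectiveModNGaloisRep p) →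
      Module.rank ℤ_[p]
          ↥(Literature.NumberTheory.EllipticCurves.Kato2004.integralH1
            (Literature.NumberTheory.EllipticCurves.Kato2004.EulerSystemValues.tateRep W p) p ⊤) ≤ 2) :
    ∀ (W : WeierstrassCurve ℚ) [W.IsElliptic] [W.IsGloballyMinimal] (p : ℕ) [Fact p.Prime]
      [ContinuousSMul ℤ_[p] (W.tateModule p)], W.analyticRank = 2 →
      (5 ≤ p ∧ Literature.NumberTheory.EllipticCurves.IsOrdinaryAt W p ∧ W.HasSurjectiveModNGaloisRep p) →
      ∀ x y : H1 (tateRep W p) ⊤,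
        x ∈ integralH1 (tateRep W p) p ⊤ → y ∈ integralH1 (tateRep W p) p ⊤ →
        (∀ k : ℕ, locModPk W p k x = 0) → (∀ k : ℕ, locModPk W p k y = 0) →
          ∃ a b : ℤ_[p], (a ≠ 0 ∨ b ≠ 0) ∧ a • x + b • y = 0 := by
  intro W _ _ p _ _ ha hdoor x y hx hy hxs hys
  obtain ⟨x₀, t, hx₀, ht, hlog⟩ := hCris W p ha hdoor
  exact strictPairDependent_of_rank_le_two_of_hasLocPKummerLog_ne_zero W p (hS2 W p ha hdoor) hx₀ hlog ht
    x y hx hy hxs hys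

end Summit.BirchSwinnertonDyer.BirchSwinnertonDyer.Theorems.DerivedKatoValuationDoor

end
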